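import Summits.QuantumFields.YangMills.Theorems.FluctuationComparisonRegPrIntLS2BetaCurlBudgetDischargedPurseJunction
import Summits.QuantumFields.YangMills.Theorems.FluctuationComparisonRegPrIntLS2BetaRemainderRowClass
import HarnessLib

/-!
# S2β · (SCT″-c)₁ — «THE c₁ LETTER WITH THE R-ROW INHABITED»: ✓p840525 `c1Budget_discharged_supDecay`'s construction with the second-order remainder letter `R`
# (`hR0`∕`hR`) and its row profile `hRa` INHABITED by ✓p840511 `exists_remainderRow_of_letters` (px20 g25, (O3-R): the (β-3)′ remainder C₇a at the clamped local letters,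
# with the explicit class `acl`) — its class inputs `hα`∕`hδ`∕`hUs`∕`hα4`∕`hδℓ` fed from the station's (BKG) binder (✓p839707), so that what remains DISPLAYED of the
# R-row is: the size profile `hMb` (+ `16·Mb i ≤ a₀`), the covariant oscillation letter `hOSC` (level constant `Olev`), the radii `ρr`, `a₀` with their windows, two
# (BKG)-side smallnesses of `α`, and the K-uniform class profile `haA : acl (i+1)² ≤ A²·(L^{2i}∕L^{2(K−J)})²` ((O3-a), px12∕px13):
# `Σ_{t<K−J} L^t·c₁(t) ≤ 2·(2·Cst·C₅)·(4·L⁻¹·(L^{K−J}·REL) + 7·(12d²Γ²(2(C_B+1)α)²·S′∕L + 192·d²·A²·S′∕L + 3·((768·c²·L)·purse))) + 2·(256·Cst·Mbar²·C_cov)·S′`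

Cell `ym3-torus` (YM ladder rung R3 = continuum `SU(2)` Yang–Mills on the three-torus at fixed lattice data — a RUNG: NOT d = 4, NOT infinite volume, NOT a mass gap,
NOT Clay).  Width seat `ym-ust-20520-w4` (gen 29); crux `stmt-QuantumFields-20520`, LINE g18-1 S2β; piece (e) (desk №720: w4 = consumer of (O3-R)∕(O3-a); DOCK CERT
posted 2026-09-01T03:11:28Z).  `--kind proof --supports stmt-QuantumFields-20520 --as helper`, count-neutral, DEFINITION-FREE (0 `def`, 0 `instance`, 0 `notation`, 0 `sorry`,
default heartbeats).

WHAT IS PROVED (sorry-free; composition BY NAME).  ★★★`c1Budget_inhabitedR`: hypotheses = ✓p840525's with `R hR0 hR a hRa ha` REPLACED by ✓p840511's displayed letters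
instantiated at the station (`P := F.P K`, `N := 2`, `r := K − J`, `U i := Ū^i U₀`): `ρr hρ0 hρr`, `a₀ ha0 ha`, `Mb hMb0 hMb hMb16`, `Olev hO0 hOSC`; plus two smallnesses
`hρα : 4·(((d+2)L)²∕4)·(2(C_B+1)α) ≤ ρr`, `hρδ : 100·ℓ·((d−1)·3L·(2(C_B+1)α)) ≤ ρr`; plus `A` and `haA : ∀ i < K−J, acl (i+1)² ≤ A²·(L^{2i}∕L^{2(K−J)})²` where `acl` is
✓p840511's class lambda VERBATIM with its `δ (i'+1)` instantiated to `(fun n => 2·((C_B+1)·α·L^(2(n−1))·(L⁻¹)^(2(K−J)))) (i'+1)`; conclusion = ✓p840525's verbatim.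
Proof: ★★`exists_remainderRow_of_bkg` = ✓p840511 at the station with `hr2` from `F.hm`, the loop∕plaquette classes from ✓p839707 §1 (`dist1_loopHol_iter_le_of_bkg`,
`plaqSmall_iter_of_bkg`), the windows `hα4`∕`hδℓ` from the two smallnesses and ✓`bkgClass_le_base`; then `c1Budget_inhabitedR` = `obtain ⟨R, hR0, hR, hRa⟩` ⊕
✓p840525 `c1Budget_discharged_supDecay` BY NAME with the class lambda `acl` passed EXPLICITLY (with `_` the elaborator postpones `?a (i+1)` and rejects `haA` — recorded
for (O3-a)).

DOMAIN LINE (plan (3) v4; desk №720 (O3) split; architect px17 g23 (S1)∕(S2) 02:00:25Z).  After this file the c₁ letter's R-row is kernel modulo: `hMb` = the SIZE profile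
((REG-UP) C-M, from Thm 2 (1.36) at the representative), `hOSC` = the covariant oscillation letter (✓p839850∕(REG-UP)′ ✓p840162 `hOSC_of_compositeLetters` output with a
level constant), `haA` = the K-uniform class profile ((O3-a): `Olev ∝ L^{2i}η²`, `(Mb i)² ∝ L^{2i}η²`, `δ·Mb`), `hζc` = (SUP-DECAY)₀, (T) windows ⟸ ✓p836413, (BKG), and
the radii windows; `B8Thm2AtT3Members` a theorem for `L ≥ 5`, `hThm2S3` at `L = 3`. [Balaban1985Averaging] (19)–(20) p.21, Prop. 3 (123), Prop. 4 (128)–(135) pp.37–38;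
[Balaban1985RegularSpaces] Thm 2 (1.36) p.83; [Balaban1987RG1] (0.1)–(0.4), (0.11), (0.18) pp.251–255.

HONEST SCOPE.  Composition of landed letters; nothing of Bałaban's renormalisation-group analysis is asserted or proved; every displayed letter is a HYPOTHESIS or
others'; GAP♯∘ (`stub_uniformFibreGapOrbit`, registry 3732b7df UNTOUCHED, 0∕5), S2β, the five registered stubs, crux 20520, 19936, 19200 and `YM3TorusSU2` are NOT proved;
no registered stub is closed; rung R3 — NOT d = 4, NOT infinite volume, NOT a mass gap, NOT Clay; the Yang–Mills mass gap is NOT proved.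
-/

set_option autoImplicit false

noncomputable section

open scoped Matrix.Norms.L2Operator
open Finset

namespace Summit.QuantumFields.YangMills.Theorems.FluctuationComparisonRegPrIntLS2BetaCurlBudgetInhabitedR

open Literature.MathematicalPhysics.QuantumFieldTheory.Balaban1983to89
open Literature.MathematicalPhysics.QuantumFieldTheory.Balaban1983to89.T4Continuum
open Literature.MathematicalPhysics.QuantumFieldTheory.Balaban1983to89.T3ContinuumYM3Torus
open Literature.MathematicalPhysics.QuantumFieldTheory.Balaban1983to89.T3LevelShift
open Literature.MathematicalPhysics.QuantumFieldTheory.Balaban1983to89.T3TiltDescent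
open Literature.MathematicalPhysics.QuantumFieldTheory.Balaban1983to89.T3UnitLawDensityEML (ℰp)
open Literature.MathematicalPhysics.QuantumFieldTheory.Balaban1983to89.T4HaarSU2ExpChart (expPoint)
open Literature.MathematicalPhysics.QuantumFieldTheory.Balaban1983to89.T4ExpWindowSmallField (logVec)
open Literature.MathematicalPhysics.QuantumFieldTheory.Balaban1983to89.HaarExponentialChart
open Literature.MathematicalPhysics.QuantumFieldTheory.Balaban1983to89.HaarExponentialChart.IsChartRep
open Literature.MathematicalPhysics.QuantumFieldTheory.Balaban1983to89.BlockAveraging (Idx blockAvg avgFun loopHol)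
open Literature.MathematicalPhysics.QuantumFieldTheory.Balaban1983to89.ExpMeanLog (expMeanLogSU deltaSU)
open Literature.MathematicalPhysics.QuantumFieldTheory.Balaban1983to89.BlockAveragingEMLLinearisedBackground (covWalkSum)
open Literature.MathematicalPhysics.QuantumFieldTheory.Balaban1983to89.B10Eq47AxialChi (shiftN)
open Literature.MathematicalPhysics.QuantumFieldTheory.Balaban1983to89.B14.Eq22Determines (blockIter)
open Literature.MathematicalPhysics.QuantumFieldTheory.Balaban1983to89.B10Eq27TorusAxialLog (rel)
open Literature.MathematicalPhysics.QuantumFieldTheory.Balaban1983to89.B10Eq18SigmaSU2 (su2Coord)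
open Literature.MathematicalPhysics.QuantumFieldTheory.Balaban1983to89.B10Eq18SigmaSU2Haar (rev)
open Literature.MathematicalPhysics.QuantumLattice (su2Quat)
open Summit.QuantumFields.YangMills.Theorems.FluctuationComparisonRegPrIntLS2BetaChartReadDescentOntoExpPoint (su2Coord_rev_mem_lie)
open Summit.QuantumFields.YangMills.Theorems.FluctuationComparisonRegPrIntLS2BetaRemainderRowClass (exists_remainderRow_of_letters)
open Summit.QuantumFields.YangMills.Theorems.FluctuationComparisonRegPrIntLS2BetaCurlBudgetDischargedPurseJunction (c1Budget_discharged_supDecay)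
open Summit.QuantumFields.YangMills.Theorems.FluctuationComparisonRegPrIntLS2BetaSourceClassesOfBkg (plaqSmall_iter_of_bkg dist1_loopHol_iter_le_of_bkg bkgClass_nonneg bkgClass_lt_two_mul bkgClass_le_base)

variable (F : T3Family)

/-- ★★ **THE R-ROW PACKAGE AT THE STATION, ITS CLASS INPUTS READ OFF (BKG)**: ✓p840511 `exists_remainderRow_of_letters` at `P := F.P K`, `N := 2`, `r := K − J`,
`U i := Ū^i U₀`, with the loop class `α(i+1) := (((d+2)L)²∕4)·θ_i`, the plaquette class `δ(i+1) := 2θ_i` (`θ_i := (C_B+1)·α·L^{2i}·(L⁻¹)^{2(K−J)}`, ✓p839707 §1) and the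
two windows `4α ≤ ρr`, `100ℓ((d−1)3L)δ ≤ ρr` from two (BKG)-side smallnesses of `α` — so the package displays only `ρr`, `a₀`, `Mb`, `Olev`∕`hOSC` and (BKG).
[cite: Balaban1985Averaging, (19)-(20) p.21, Prop. 3 (123) p.36; Balaban1987RG1, (0.18) p.255] -/
theorem exists_remainderRow_of_bkg {J K : ℕ}
    (U₀ : GaugeField (F.P K) 0 (Matrix.specialUnitaryGroup (Fin 2) ℂ))
    (X : (i : ℕ) → PBond (F.P K) i → (specialUnitaryLogChart (Fin 2)).lie)
    (C_B α : ℝ) (hCB : 0 ≤ C_B) (hα : 0 < α)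
    (hBKG : ∀ t, t ≤ K - J → ∀ p : Plaq (F.P K) t,
      dist1 (GaugeField.plaqHol (Averaging.iter (fun k => BlockAveraging.blockAvg (P := F.P K) (j := k) ℰp) t U₀) p) ≤
        C_B * α * (F.L : ℝ) ^ (2 * t) * ((F.L : ℝ)⁻¹) ^ (2 * (K - J)))
    {ρr : ℝ} (hρ0 : 0 < ρr) (hρr : ρr ≤ innerRadius (specialUnitaryLogChart (Fin 2)))
    {a₀ : ℝ} (ha0 : 0 < a₀) (ha : 100 * (((((F.P K).d + 2) * (F.P K).L : ℕ) : ℝ) * (Real.exp a₀ - 1)) ≤ ρr)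
    (Mb : ℕ → ℝ) (hMb0 : ∀ i, i < K - J → 0 ≤ Mb i) (hMb : ∀ i, i < K - J → ∀ b : PBond (F.P K) i, ‖X i b‖ ≤ Mb i) (hMb16 : ∀ i, i < K - J → 16 * Mb i ≤ a₀)
    (Olev : ℕ → ℝ) (hO0 : ∀ i, i < K - J → 0 ≤ Olev (i + 1))
    (hOSC : ∀ μ ν : Fin (F.P K).d, μ < ν → ∀ i, i < K - J → ∀ (y' : Site (F.P K) (i + 1)) (b b' : PBond (F.P K) i), (blockOf b.src = y' ∨ blockOf b.src = y'.shift μ ∨ blockOf b.src = y'.shift ν ∨ blockOf b.src = (y'.shift μ).shift ν) → (blockOf b'.src = y' ∨ blockOf b'.src = y'.shift μ ∨ blockOf b'.src = y'.shift ν ∨ blockOf b'.src = (y'.shift μ).shift ν) → b.dir = b'.dir →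
      ‖(((T4AxialGaugeSmallField.axialGauge (Averaging.iter (fun k => BlockAveraging.blockAvg (P := F.P K) (j := k) ℰp) i U₀) (fun κ : Fin (F.P K).d => (((emb y' κ).val : ℕ) : ℤ) - ((((F.P K).L - 1) / 2 : ℕ) : ℤ)) (fun κ : Fin (F.P K).d => (((emb y' κ).val : ℕ) : ℤ) + (((if κ = μ then ((F.P K).L : ℤ) else 0) + (if κ = ν then ((F.P K).L : ℤ) else 0)) + ((((F.P K).L - 1) / 2 : ℕ) : ℤ)) + 1)) b.src : Matrix.specialUnitaryGroup (Fin 2) ℂ) : Matrix (Fin 2) (Fin 2) ℂ) * ((X i b : (specialUnitaryLogChart (Fin 2)).lie) : Matrix (Fin 2) (Fin 2) ℂ) * star (((T4AxialGaugeSmallField.axialGauge (Averaging.iter (fun k => BlockAveraging.blockAvg (P := F.P K) (j := k) ℰp) i U₀) (fun κ : Fin (F.P K).d => (((emb y' κ).val : ℕ) : ℤ) - ((((F.P K).L - 1) / 2 : ℕ) : ℤ)) (fun κ : Fin (F.P K).d => (((emb y' κ).val : ℕ) : ℤ) + (((if κ = μ then ((F.P K).L : ℤ) else 0) + (if κ =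 ν then ((F.P K).L : ℤ) else 0)) + ((((F.P K).L - 1) / 2 : ℕ) : ℤ)) + 1)) b.src : Matrix.specialUnitaryGroup (Fin 2) ℂ) : Matrix (Fin 2) (Fin 2) ℂ) -
        ((((T4AxialGaugeSmallField.axialGauge (Averaging.iter (fun k => BlockAveraging.blockAvg (P := F.P K) (j := k) ℰp) i U₀) (fun κ : Fin (F.P K).d => (((emb y' κ).val : ℕ) : ℤ) - ((((F.P K).L - 1) / 2 : ℕ) : ℤ)) (fun κ : Fin (F.P K).d => (((emb y' κ).val : ℕ) : ℤ) + (((if κ = μ then ((F.P K).L : ℤ) else 0) + (if κ = ν then ((F.P K).L : ℤ) else 0)) + ((((F.P K).L - 1) / 2 : ℕ) : ℤ)) + 1)) b'.src : Matrix.specialUnitaryGroup (Fin 2) ℂ) : Matrix (Fin 2) (Fin 2) ℂ) * ((X i b' : (specialUnitaryLogChart (Fin 2)).lie) : Matrix (Fin 2) (Fin 2) ℂ) * star (((T4AxialGaugeSmallField.axialGauge (Averaging.iter (fun k => BlockAveraging.blockAvg (P := F.P K) (j := k) ℰp) i U₀) (fun κ : Fin (F.P K).d => (((emb y' κ).val :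 ℕ) : ℤ) - ((((F.P K).L - 1) / 2 : ℕ) : ℤ)) (fun κ : Fin (F.P K).d => (((emb y' κ).val : ℕ) : ℤ) + (((if κ = μ then ((F.P K).L : ℤ) else 0) + (if κ = ν then ((F.P K).L : ℤ) else 0)) + ((((F.P K).L - 1) / 2 : ℕ) : ℤ)) + 1)) b'.src : Matrix.specialUnitaryGroup (Fin 2) ℂ) : Matrix (Fin 2) (Fin 2) ℂ))‖ ≤ Olev (i + 1))
    (hρα : 4 * ((((((F.P K).d + 2) * (F.P K).L : ℕ) : ℝ) ^ 2 / 4) * (2 * ((C_B + 1) * α))) ≤ ρr)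
    (hρδ : 100 * (((((F.P K).d + 2) * (F.P K).L : ℕ) : ℝ) * ((((F.P K).d - 1 : ℕ) : ℝ) * ((3 * (F.P K).L : ℕ) : ℝ) * (2 * ((C_B + 1) * α)))) ≤ ρr) :
    ∃ R : Fin (F.P K).d → Fin (F.P K).d → (i : ℕ) → Site (F.P K) i → ℝ,
      (∀ μ ν i x, 0 ≤ R μ ν i x) ∧
      (∀ μ ν : Fin (F.P K).d, μ < ν → ∀ i, i < K - J → ∀ (y' : Site (F.P K) (i + 1)) (c : PBond (F.P K) (i + 1)), (c = ⟨y', μ⟩ ∨ c = ⟨y'.shift μ, ν⟩ ∨ c = ⟨y'.shift ν, μ⟩ ∨ c = ⟨y', ν⟩) →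
        ‖(((isChartRep_specialUnitaryGroup (n := Fin 2)).logChart (avgFun (expMeanLogSU (n := Fin 2)) (fun b => (isChartRep_specialUnitaryGroup (n := Fin 2)).expChart (X i b) * Averaging.iter (fun k => BlockAveraging.blockAvg (P := F.P K) (j := k) ℰp) i U₀ b) c * (avgFun (expMeanLogSU (n := Fin 2)) (Averaging.iter (fun k => BlockAveraging.blockAvg (P := F.P K) (j := k) ℰp) i U₀) c)⁻¹) : (specialUnitaryLogChart (Fin 2)).lie) : Matrix (Fin 2) (Fin 2) ℂ) -
        ((fderiv ℝ (fun (A : PBond (F.P K) i → (specialUnitaryLogChart (Fin 2)).lie) (c : PBond (F.P K) (i + 1)) => (isChartRep_specialUnitaryGroup (n := Fin 2)).logChart (avgFun (expMeanLogSU (n := Fin 2)) (fun b => (isChartRep_specialUnitaryGroup (n := Fin 2)).expChart (A b) * Averaging.iter (fun k => BlockAveraging.blockAvg (P := F.P K) (j := k) ℰp) i U₀ b) c * (avgFun (expMeanLogSU (n := Fin 2)) (Averaging.iter (fun k => BlockAveraging.blockAvg (P := F.P K) (j := k) ℰp) i U₀) c)⁻¹)) 0 (X i) c : (specialUnitaryLogChart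 (Fin 2)).lie) : Matrix (Fin 2) (Fin 2) ℂ)‖ ≤ R μ ν (i + 1) y') ∧
      (∀ (μ ν : Fin (F.P K).d) (i : ℕ), i < K - J → ∀ y' : Site (F.P K) (i + 1),
        R μ ν (i + 1) y' ^ 2 ≤ (fun (i : ℕ) => match i with
      | 0 => (0 : ℝ)
      | i' + 1 => 16 * (54 * (((((F.P K).d + 2) * (F.P K).L : ℕ) : ℝ) * (Real.exp a₀ - 1))) * Olev (i' + 1) / (a₀ - Mb i') ^ 2 + 32 * (54 * (((((F.P K).d + 2) * (F.P K).L : ℕ) : ℝ) * (Real.exp a₀ - 1))) * Olev (i' + 1) / a₀ ^ 2 +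
          ((((F.P K).d + 2) * (F.P K).L : ℕ) : ℝ) ^ 3 * (Mb i') ^ 2 + 8 * (67 * (((((F.P K).d + 2) * (F.P K).L : ℕ) : ℝ) * ((((F.P K).d - 1 : ℕ) : ℝ) * ((3 * (F.P K).L : ℕ) : ℝ) * (fun n : ℕ => 2 * ((C_B + 1) * α * (F.L : ℝ) ^ (2 * (n - 1)) * ((F.L : ℝ)⁻¹) ^ (2 * (K - J)))) (i' + 1)))) * Mb i' / a₀ ^ 2 : ℕ → ℝ) (i + 1) ^ 2 * ∑ b ∈ (univ.filter (fun b : PBond (F.P K) i => blockOf b.src = y' ∨ blockOf b.src = y'.shift μ ∨ blockOf b.src = y'.shift ν ∨ blockOf b.src = (y'.shift μ).shift ν)), ‖X i b‖ ^ 2) := by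
  have hL2 : (2 : ℝ) ≤ (F.L : ℝ) := by exact_mod_cast F.hL.2
  have hL1 : (1 : ℝ) ≤ (F.L : ℝ) := by linarith
  have hL0 : (0 : ℝ) ≤ (F.L : ℝ) := by linarith
  have hCB1 : (0 : ℝ) ≤ C_B + 1 := by linarith
  have hpos : 0 < (C_B + 1) * α := by positivity
  have hBKG' : ∀ t, t ≤ K - J → ∀ p : Plaq (F.P K) t,
      dist1 (GaugeField.plaqHol (Averaging.iter (fun k => BlockAveraging.blockAvg (P := F.P K) (j := k) ℰp) t U₀) p) ≤
        (C_B + 1) * α * (F.L : ℝ) ^ (2 * t) * ((F.L : ℝ)⁻¹) ^ (2 * (K - J)) := by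
    intro t ht p
    refine (hBKG t ht p).trans ?_
    have h0 : 0 ≤ α * (F.L : ℝ) ^ (2 * t) * ((F.L : ℝ)⁻¹) ^ (2 * (K - J)) :=
      mul_nonneg (mul_nonneg hα.le (pow_nonneg hL0 _)) (pow_nonneg (inv_nonneg.2 hL0) _)
    have h1 : C_B * α * (F.L : ℝ) ^ (2 * t) * ((F.L : ℝ)⁻¹) ^ (2 * (K - J)) =
        C_B * (α * (F.L : ℝ) ^ (2 * t) * ((F.L : ℝ)⁻¹) ^ (2 * (K - J))) := by ring
    have h2 : (C_B + 1) * α * (F.L : ℝ) ^ (2 * t) * ((F.L : ℝ)⁻¹) ^ (2 * (K - J)) =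
        (C_B + 1) * (α * (F.L : ℝ) ^ (2 * t) * ((F.L : ℝ)⁻¹) ^ (2 * (K - J))) := by ring
    rw [h1, h2]
    exact mul_le_mul_of_nonneg_right (by linarith) h0
  have hr2 : K - J + 1 ≤ (F.P K).m + (F.P K).K := by
    have hm := F.hm
    show K - J + 1 ≤ F.m + K
    omega
  have hKA0 : (0 : ℝ) ≤ (((((F.P K).d + 2) * (F.P K).L : ℕ) : ℝ) ^ 2 / 4) := by positivity
  have hθle : ∀ i, i < K - J → (C_B + 1) * α * (F.L : ℝ) ^ (2 * i) * ((F.L : ℝ)⁻¹) ^ (2 * (K - J)) ≤ (C_B + 1) * α :=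
    fun i hi => bkgClass_le_base F (C_B + 1) α hCB1 hα.le hL1 hi.le
  -- loop class: `α(i+1) := kα·θ_i` (lit `dist1_loopHol_le'` via ✓p839707 §1)
  have hαq : ∀ i, i < K - J → ∀ (c : PBond (F.P K) (i + 1)) (ι : Idx (F.P K)),
      dist1 (loopHol (Averaging.iter (fun k => BlockAveraging.blockAvg (P := F.P K) (j := k) ℰp) i U₀) c ι) ≤ (fun n : ℕ => (((((F.P K).d + 2) * (F.P K).L : ℕ) : ℝ) ^ 2 / 4) * ((C_B + 1) * α * (F.L : ℝ) ^ (2 * (n - 1)) * ((F.L : ℝ)⁻¹) ^ (2 * (K - J)))) (i + 1) := by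
    intro i hi c ι
    simp only [Nat.add_sub_cancel]
    exact dist1_loopHol_iter_le_of_bkg F U₀ (C_B + 1) α hCB1 hα.le hBKG' i hi c ι
  have hα4 : ∀ i, i < K - J → 4 * (fun n : ℕ => (((((F.P K).d + 2) * (F.P K).L : ℕ) : ℝ) ^ 2 / 4) * ((C_B + 1) * α * (F.L : ℝ) ^ (2 * (n - 1)) * ((F.L : ℝ)⁻¹) ^ (2 * (K - J)))) (i + 1) ≤ ρr := by
    intro i hi
    simp only [Nat.add_sub_cancel]
    have h := mul_le_mul_of_nonneg_left (hθle i hi) hKA0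
    nlinarith [hρα, h]
  have hδ0 : ∀ i, i < K - J → 0 ≤ (fun n : ℕ => 2 * ((C_B + 1) * α * (F.L : ℝ) ^ (2 * (n - 1)) * ((F.L : ℝ)⁻¹) ^ (2 * (K - J)))) (i + 1) := by
    intro i _
    exact mul_nonneg zero_le_two (bkgClass_nonneg F (C_B + 1) α hCB1 hα.le _)
  have hUs : ∀ i, i < K - J → PlaqSmall ((fun n : ℕ => 2 * ((C_B + 1) * α * (F.L : ℝ) ^ (2 * (n - 1)) * ((F.L : ℝ)⁻¹) ^ (2 * (K - J)))) (i + 1))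
      (Averaging.iter (fun k => BlockAveraging.blockAvg (P := F.P K) (j := k) ℰp) i U₀) := by
    intro i hi
    simp only [Nat.add_sub_cancel]
    exact plaqSmall_iter_of_bkg F U₀ (C_B + 1) α hBKG'
      (fun n => 2 * ((C_B + 1) * α * (F.L : ℝ) ^ (2 * n) * ((F.L : ℝ)⁻¹) ^ (2 * (K - J)))) (fun n _ => bkgClass_lt_two_mul F (C_B + 1) α hpos (by linarith) n) i hi
  have hδℓ : ∀ i, i < K - J → 100 * (((((F.P K).d + 2) * (F.P K).L : ℕ) : ℝ) * ((((F.P K).d - 1 : ℕ) : ℝ) * ((3 * (F.P K).L : ℕ) : ℝ) * (fun n : ℕ => 2 * ((C_B + 1) * α * (F.L : ℝ) ^ (2 * (n - 1)) * ((F.L : ℝ)⁻¹) ^ (2 * (K - J)))) (i + 1))) ≤ ρr := by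
    intro i hi
    simp only [Nat.add_sub_cancel]
    have h := hθle i hi
    have hc0 : (0 : ℝ) ≤ 100 * (((((F.P K).d + 2) * (F.P K).L : ℕ) : ℝ) * ((((F.P K).d - 1 : ℕ) : ℝ) * ((3 * (F.P K).L : ℕ) : ℝ))) := by positivity
    have e1 : 100 * (((((F.P K).d + 2) * (F.P K).L : ℕ) : ℝ) * ((((F.P K).d - 1 : ℕ) : ℝ) * ((3 * (F.P K).L : ℕ) : ℝ) * (2 * ((C_B + 1) * α * (F.L : ℝ) ^ (2 * i) * ((F.L : ℝ)⁻¹) ^ (2 * (K - J)))))) =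
        100 * (((((F.P K).d + 2) * (F.P K).L : ℕ) : ℝ) * ((((F.P K).d - 1 : ℕ) : ℝ) * ((3 * (F.P K).L : ℕ) : ℝ))) * (2 * ((C_B + 1) * α * (F.L : ℝ) ^ (2 * i) * ((F.L : ℝ)⁻¹) ^ (2 * (K - J)))) := by ring
    have e2 : 100 * (((((F.P K).d + 2) * (F.P K).L : ℕ) : ℝ) * ((((F.P K).d - 1 : ℕ) : ℝ) * ((3 * (F.P K).L : ℕ) : ℝ) * (2 * ((C_B + 1) * α)))) =
        100 * (((((F.P K).d + 2) * (F.P K).L : ℕ) : ℝ) * ((((F.P K).d - 1 : ℕ) : ℝ) * ((3 * (F.P K).L : ℕ) : ℝ))) * (2 * ((C_B + 1) * α)) := by ring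
    rw [e1]
    rw [e2] at hρδ
    exact (mul_le_mul_of_nonneg_left (by linarith) hc0).trans hρδ
  exact exists_remainderRow_of_letters (P := F.P K) (N := 2) (K - J) hr2
    (fun i => Averaging.iter (fun k => BlockAveraging.blockAvg (P := F.P K) (j := k) ℰp) i U₀) X hρ0 hρr (fun n : ℕ => (((((F.P K).d + 2) * (F.P K).L : ℕ) : ℝ) ^ 2 / 4) * ((C_B + 1) * α * (F.L : ℝ) ^ (2 * (n - 1)) * ((F.L : ℝ)⁻¹) ^ (2 * (K - J)))) (fun n : ℕ => 2 * ((C_B + 1) * α * (F.L : ℝ) ^ (2 * (n - 1)) * ((F.L : ℝ)⁻¹) ^ (2 * (K - J))))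
    hαq hα4 hδ0 hUs hδℓ ha0 ha Mb hMb0 hMb hMb16 Olev hO0 hOSC

/-- ★★★ **THE c₁ LETTER WITH THE R-ROW INHABITED** — ✓`c1Budget_discharged_supDecay`'s construction ∘ ✓`exists_remainderRow_of_letters` (its class inputs from
(BKG)); see the module header. [cite: Balaban1985Averaging, Prop. 3 (123), Prop. 4 (128)-(135) pp.37-38; Balaban1985RegularSpaces, Thm 2 (1.36) p.83; Balaban1987RG1, (0.11), (0.18) pp.253-255] -/
theorem c1Budget_inhabitedR {J K : ℕ} (hJK : J ≤ K) (Cst : ℝ) (hCst : 0 ≤ Cst)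
    (U₀ : GaugeField (F.P K) 0 (Matrix.specialUnitaryGroup (Fin 2) ℂ)) (ζ : PBond (F.P K) 0 → EuclideanSpace ℝ (Fin 3))
    (X : (i : ℕ) → PBond (F.P K) i → (specialUnitaryLogChart (Fin 2)).lie)
    (hXdef : X = fun (i : ℕ) (b : PBond (F.P K) i) =>
      (⟨su2Coord (rev (logVec (su2Quat (Averaging.iter (fun k => BlockAveraging.blockAvg (P := F.P K) (j := k) ℰp) i (fun ℓ => expPoint (ζ ℓ) * U₀ ℓ : GaugeField (F.P K) 0 (Matrix.specialUnitaryGroup (Fin 2) ℂ)) b * (Averaging.iter (fun k => BlockAveraging.blockAvg (P := F.P K) (j := k) ℰp) i U₀ b)⁻¹)))), su2Coord_rev_mem_lie _⟩ : (specialUnitaryLogChart (Fin 2)).lie))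
    (Mg : ℕ → ℝ) (hMg : ∀ t, t ≤ K - J → ∀ b : PBond (F.P K) t,
      ‖logVec (su2Quat (Averaging.iter (fun k => BlockAveraging.blockAvg (P := F.P K) (j := k) ℰp) t (fun ℓ => expPoint (ζ ℓ) * U₀ ℓ : GaugeField (F.P K) 0 (Matrix.specialUnitaryGroup (Fin 2) ℂ)) b * (Averaging.iter (fun k => BlockAveraging.blockAvg (P := F.P K) (j := k) ℰp) t U₀ b)⁻¹))‖ ≤ Mg t)
    (hMg4 : ∀ t, t ≤ K - J → Mg t ≤ 1 / 4)
    (C_B α : ℝ) (hCB : 0 ≤ C_B) (hα : 0 < α)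
    (hBKG : ∀ t, t ≤ K - J → ∀ p : Plaq (F.P K) t,
      dist1 (GaugeField.plaqHol (Averaging.iter (fun k => BlockAveraging.blockAvg (P := F.P K) (j := k) ℰp) t U₀) p) ≤
        C_B * α * (F.L : ℝ) ^ (2 * t) * ((F.L : ℝ)⁻¹) ^ (2 * (K - J)))
    (h24 : ((((F.P K).d + 2) * (F.P K).L : ℕ) : ℝ) ^ 2 / 4 * ((C_B + 1) * α) ≤ 1 / 24)
    (hSU : ((((F.P K).d + 2) * (F.P K).L : ℕ) : ℝ) ^ 2 / 4 * ((C_B + 1) * α) < deltaSU (Fin 2))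
    {ρr : ℝ} (hρ0 : 0 < ρr) (hρr : ρr ≤ innerRadius (specialUnitaryLogChart (Fin 2)))
    {a₀ : ℝ} (ha0 : 0 < a₀) (ha : 100 * (((((F.P K).d + 2) * (F.P K).L : ℕ) : ℝ) * (Real.exp a₀ - 1)) ≤ ρr)
    (Mb : ℕ → ℝ) (hMb0 : ∀ i, i < K - J → 0 ≤ Mb i) (hMb : ∀ i, i < K - J → ∀ b : PBond (F.P K) i, ‖X i b‖ ≤ Mb i) (hMb16 : ∀ i, i < K - J → 16 * Mb i ≤ a₀)
    (Olev : ℕ → ℝ) (hO0 : ∀ i, i < K - J → 0 ≤ Olev (i + 1))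
    (hOSC : ∀ μ ν : Fin (F.P K).d, μ < ν → ∀ i, i < K - J → ∀ (y' : Site (F.P K) (i + 1)) (b b' : PBond (F.P K) i), (blockOf b.src = y' ∨ blockOf b.src = y'.shift μ ∨ blockOf b.src = y'.shift ν ∨ blockOf b.src = (y'.shift μ).shift ν) → (blockOf b'.src = y' ∨ blockOf b'.src = y'.shift μ ∨ blockOf b'.src = y'.shift ν ∨ blockOf b'.src = (y'.shift μ).shift ν) → b.dir = b'.dir →
      ‖(((T4AxialGaugeSmallField.axialGauge (Averaging.iter (fun k => BlockAveraging.blockAvg (P := F.P K) (j := k) ℰp) i U₀) (fun κ : Fin (F.P K).d => (((emb y' κ).val : ℕ) : ℤ) - ((((F.P K).L - 1) / 2 : ℕ) : ℤ)) (fun κ : Fin (F.P K).d => (((emb y' κ).val : ℕ) : ℤ) + (((if κ = μ then ((F.P K).L : ℤ) else 0) + (if κ = ν then ((F.P K).L : ℤ) else 0)) + ((((F.P K).L - 1) / 2 : ℕ) : ℤ)) + 1)) b.src : Matrix.specialUnitaryGroup (Fin 2) ℂ) : Matrix (Fin 2) (Fin 2) ℂ) * ((X i b : (specialUnitaryLogChart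 (Fin 2)).lie) : Matrix (Fin 2) (Fin 2) ℂ) * star (((T4AxialGaugeSmallField.axialGauge (Averaging.iter (fun k => BlockAveraging.blockAvg (P := F.P K) (j := k) ℰp) i U₀) (fun κ : Fin (F.P K).d => (((emb y' κ).val : ℕ) : ℤ) - ((((F.P K).L - 1) / 2 : ℕ) : ℤ)) (fun κ : Fin (F.P K).d => (((emb y' κ).val : ℕ) : ℤ) + (((if κ = μ then ((F.P K).L : ℤ) else 0) + (if κ = ν then ((F.P K).L : ℤ) else 0)) + ((((F.P K).L - 1) / 2 : ℕ) : ℤ)) + 1)) b.src : Matrix.specialUnitaryGroup (Fin 2) ℂ) : Matrix (Fin 2) (Fin 2) ℂ) -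
        ((((T4AxialGaugeSmallField.axialGauge (Averaging.iter (fun k => BlockAveraging.blockAvg (P := F.P K) (j := k) ℰp) i U₀) (fun κ : Fin (F.P K).d => (((emb y' κ).val : ℕ) : ℤ) - ((((F.P K).L - 1) / 2 : ℕ) : ℤ)) (fun κ : Fin (F.P K).d => (((emb y' κ).val : ℕ) : ℤ) + (((if κ = μ then ((F.P K).L : ℤ) else 0) + (if κ = ν then ((F.P K).L : ℤ) else 0)) + ((((F.P K).L - 1) / 2 : ℕ) : ℤ)) + 1)) b'.src : Matrix.specialUnitaryGroup (Fin 2) ℂ) : Matrix (Fin 2) (Fin 2) ℂ) * ((X i b' : (specialUnitaryLogChart (Fin 2)).lie) : Matrix (Fin 2) (Fin 2) ℂ) * star (((T4AxialGaugeSmallField.axialGauge (Averaging.iter (fun k => BlockAveraging.blockAvg (P := F.P K) (j := k) ℰp) i U₀) (fun κ : Fin (F.P K).d => (((emb y' κ).val : ℕ) : ℤ) - ((((F.P K).L - 1) / 2 : ℕ) : ℤ)) (fun κ : Fin (F.P K).d => (((emb y' κ).val : ℕ) : ℤ) + (((if κ = μ then ((F.P K).L : ℤ) else 0) + (if κ =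 ν then ((F.P K).L : ℤ) else 0)) + ((((F.P K).L - 1) / 2 : ℕ) : ℤ)) + 1)) b'.src : Matrix.specialUnitaryGroup (Fin 2) ℂ) : Matrix (Fin 2) (Fin 2) ℂ))‖ ≤ Olev (i + 1))
    (hρα : 4 * ((((((F.P K).d + 2) * (F.P K).L : ℕ) : ℝ) ^ 2 / 4) * (2 * ((C_B + 1) * α))) ≤ ρr)
    (hρδ : 100 * (((((F.P K).d + 2) * (F.P K).L : ℕ) : ℝ) * ((((F.P K).d - 1 : ℕ) : ℝ) * ((3 * (F.P K).L : ℕ) : ℝ) * (2 * ((C_B + 1) * α)))) ≤ ρr)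
    (A : ℝ)
    (haA : ∀ i, i < K - J → (fun (i : ℕ) => match i with
      | 0 => (0 : ℝ)
      | i' + 1 => 16 * (54 * (((((F.P K).d + 2) * (F.P K).L : ℕ) : ℝ) * (Real.exp a₀ - 1))) * Olev (i' + 1) / (a₀ - Mb i') ^ 2 + 32 * (54 * (((((F.P K).d + 2) * (F.P K).L : ℕ) : ℝ) * (Real.exp a₀ - 1))) * Olev (i' + 1) / a₀ ^ 2 +
          ((((F.P K).d + 2) * (F.P K).L : ℕ) : ℝ) ^ 3 * (Mb i') ^ 2 + 8 * (67 * (((((F.P K).d + 2) * (F.P K).L : ℕ) : ℝ) * ((((F.P K).d - 1 : ℕ) : ℝ) * ((3 * (F.P K).L : ℕ) : ℝ) * (fun n : ℕ => 2 * ((C_B + 1) * α * (F.L : ℝ) ^ (2 * (n - 1)) * ((F.L : ℝ)⁻¹) ^ (2 * (K - J)))) (i' + 1)))) * Mb i' / a₀ ^ 2 : ℕ → ℝ) (i + 1) ^ 2 ≤ A ^ 2 * ((F.L : ℝ) ^ (2 * i) / (F.L : ℝ) ^ (2 * (K - J))) ^ 2)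
    (c : ℝ) (hc0 : 0 ≤ c) (hc4 : 4 * c ≤ 1)
    (hζc : ∀ ℓ : PBond (F.P K) 0, ‖ζ ℓ‖ ≤ c * ((F.L : ℝ)⁻¹) ^ (K - J))
    (Mbar : ℝ) (hM0 : 0 ≤ Mbar) (hM1 : 4 * Mbar ≤ 1)
    (hM : ∀ s, s < K - J → ∀ b : PBond (F.P K) s, ‖logVec (su2Quat (Averaging.iter (fun k => BlockAveraging.blockAvg (P := F.P K) (j := k) ℰp) s (fun ℓ => expPoint (ζ ℓ) * U₀ ℓ : GaugeField (F.P K) 0 (Matrix.specialUnitaryGroup (Fin 2) ℂ)) b * (Averaging.iter (fun k => BlockAveraging.blockAvg (P := F.P K) (j := k) ℰp) s U₀ b)⁻¹))‖ ≤ Mbar) :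
    ∑ t ∈ Finset.range (K - J), (F.L : ℝ) ^ t * (fun t => Cst * ∑ B : PBond (F.P J) 0,
      ‖(fun p : Plaq (F.P K) (K - J - 1 - t) =>
        if ∃ z₀ : Site (F.P K) 0, (blockIter (K - J) z₀ = (bondShift (F.sitesPerDir_eq (m := F.m) (K := J) (j := 0) (m' := F.m) (K' := K) (j' := K - J) (by omega)) B).src ∨
            blockIter (K - J) z₀ = (bondShift (F.sitesPerDir_eq (m := F.m) (K := J) (j := 0) (m' := F.m) (K' := K) (j' := K - J) (by omega)) B).tgt) ∧
            ∀ κ, (rel (blockIter (K - J - 1 - t) z₀) p.src κ).natAbs ≤ (2 * F.L + 1)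
        then dist1 ((GaugeField.plaqHol (Averaging.iter (fun k => BlockAveraging.blockAvg (P := F.P K) (j := k) ℰp) (K - J - 1 - t) U₀) p)⁻¹ *
          GaugeField.plaqHol (Averaging.iter (fun k => BlockAveraging.blockAvg (P := F.P K) (j := k) ℰp) (K - J - 1 - t)
            (fun ℓ => expPoint (ζ ℓ) * U₀ ℓ : GaugeField (F.P K) 0 (Matrix.specialUnitaryGroup (Fin 2) ℂ))) p)
        else 0)‖ ^ 2) t ≤
      2 * ((2 * Cst * (((5 ^ (F.P K).d : ℕ) : ℝ) ^ 2 * (((2 * ((2 * F.L + 1) + 2) + 1) ^ (F.P K).d * 6 : ℕ) : ℝ) *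
              (2 * ((((F.P K).L ^ (F.P K).d : ℕ) : ℝ) - 1) / ((((F.P K).L ^ (F.P K).d : ℕ) : ℝ) - 3)))) * (4 * (F.L : ℝ)⁻¹ * ((F.L : ℝ) ^ (K - J) * ∑ p : Plaq (F.P K) 0,
                  (1 - reTr ((GaugeField.plaqHol U₀ p)⁻¹ * GaugeField.plaqHol (fun ℓ => expPoint (ζ ℓ) * U₀ ℓ : GaugeField (F.P K) 0 (Matrix.specialUnitaryGroup (Fin 2) ℂ)) p))) + 7 *
      (12 * ((F.P K).d : ℝ) ^ 2 * (2 * ((F.P K).L : ℝ) ^ 2 * (3 * (F.P K).L + 2) + 2 * ((F.P K).L : ℝ) ^ 2 + (48 * (F.P K).L + 24 * ((((F.P K).d + 2) * (F.P K).L : ℕ) : ℝ) + 1616 * ((((F.P K).d + 2) * (F.P K).L : ℕ) : ℝ)) * (((((F.P K).d + 2) * (F.P K).L : ℕ) : ℝ) ^ 2 / 4) +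
        2 * ((((F.P K).d + 2) * (F.P K).L : ℕ) : ℝ) * ((F.L : ℝ) ^ 2)) ^ 2 * (2 * ((C_B + 1) * α)) ^ 2 *
        (∑ t ∈ Finset.range (K - J), (if ht : t < K - J then
          (F.L : ℝ) ^ t * ∑ B : PBond (F.P J) 0,
            ‖(fun ℓ' : PBond (F.P (J + (t + 1))) 0 =>
              if ∃ z : Site (F.P (J + (t + 1))) 0,
                (B14.Eq22Determines.blockIter (t + 1) z = (bondShift (F.sitesPerDir_eq (m := F.m) (K := J) (j := 0) (m' := F.m) (K' := J + (t + 1)) (j' := t + 1) (by omega)) B).src ∨ B14.Eq22Determines.blockIter (t + 1) z = (bondShift (F.sitesPerDir_eq (m := F.m) (K := J) (j := 0) (m' := F.m) (K' := J + (t + 1)) (j' := t + 1) (by omega)) B).tgt) ∧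
                ∀ ν, (B10Eq27TorusAxialLog.rel z ℓ'.src ν).natAbs ≤ 2
              then logVec (su2Quat (descendTo F ℰp (J + (t + 1)) K (by omega) (fun ℓ => expPoint (ζ ℓ) * U₀ ℓ : GaugeField (F.P K) 0 (Matrix.specialUnitaryGroup (Fin 2) ℂ)) ℓ' * (descendTo F ℰp (J + (t + 1)) K (by omega) U₀ ℓ')⁻¹)) else 0)‖ ^ 2
        else 0)) / (F.L : ℝ) +
      (192 * ((F.P K).d : ℝ) ^ 2 * A ^ 2 *
        (∑ t ∈ Finset.range (K - J), (if ht : t < K - J then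
          (F.L : ℝ) ^ t * ∑ B : PBond (F.P J) 0,
            ‖(fun ℓ' : PBond (F.P (J + (t + 1))) 0 =>
              if ∃ z : Site (F.P (J + (t + 1))) 0,
                (B14.Eq22Determines.blockIter (t + 1) z = (bondShift (F.sitesPerDir_eq (m := F.m) (K := J) (j := 0) (m' := F.m) (K' := J + (t + 1)) (j' := t + 1) (by omega)) B).src ∨ B14.Eq22Determines.blockIter (t + 1) z = (bondShift (F.sitesPerDir_eq (m := F.m) (K := J) (j := 0) (m' := F.m) (K' := J + (t + 1)) (j' := t + 1) (by omega)) B).tgt) ∧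
                ∀ ν, (B10Eq27TorusAxialLog.rel z ℓ'.src ν).natAbs ≤ 2
              then logVec (su2Quat (descendTo F ℰp (J + (t + 1)) K (by omega) (fun ℓ => expPoint (ζ ℓ) * U₀ ℓ : GaugeField (F.P K) 0 (Matrix.specialUnitaryGroup (Fin 2) ℂ)) ℓ' * (descendTo F ℰp (J + (t + 1)) K (by omega) U₀ ℓ')⁻¹)) else 0)‖ ^ 2
        else 0)) / (F.L : ℝ)) +
      3 * ((768 * c ^ 2 * (F.L : ℝ)) *
        (((F.L : ℝ)⁻¹) ^ (K - J) * ∑ ℓ : PBond (F.P K) 0, ‖ζ ℓ‖ ^ 2 +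
          (F.L : ℝ) ^ (K - J) * ∑ p : Plaq (F.P K) 0,
            (1 - reTr ((GaugeField.plaqHol U₀ p)⁻¹ * GaugeField.plaqHol (fun ℓ => expPoint (ζ ℓ) * U₀ ℓ : GaugeField (F.P K) 0 (Matrix.specialUnitaryGroup (Fin 2) ℂ)) p))))))) +
      2 * ((256 * Cst * Mbar ^ 2 * ((2 * (F.P J).d * (2 * 3 + 1) ^ (F.P J).d : ℕ) : ℝ)) * (∑ t ∈ Finset.range (K - J), (if ht : t < K - J then
          (F.L : ℝ) ^ t * ∑ B : PBond (F.P J) 0,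
            ‖(fun ℓ' : PBond (F.P (J + (t + 1))) 0 =>
              if ∃ z : Site (F.P (J + (t + 1))) 0,
                (B14.Eq22Determines.blockIter (t + 1) z = (bondShift (F.sitesPerDir_eq (m := F.m) (K := J) (j := 0) (m' := F.m) (K' := J + (t + 1)) (j' := t + 1) (by omega)) B).src ∨ B14.Eq22Determines.blockIter (t + 1) z = (bondShift (F.sitesPerDir_eq (m := F.m) (K := J) (j := 0) (m' := F.m) (K' := J + (t + 1)) (j' := t + 1) (by omega)) B).tgt) ∧
                ∀ ν, (B10Eq27TorusAxialLog.rel z ℓ'.src ν).natAbs ≤ 2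
              then logVec (su2Quat (descendTo F ℰp (J + (t + 1)) K (by omega) (fun ℓ => expPoint (ζ ℓ) * U₀ ℓ : GaugeField (F.P K) 0 (Matrix.specialUnitaryGroup (Fin 2) ℂ)) ℓ' * (descendTo F ℰp (J + (t + 1)) K (by omega) U₀ ℓ')⁻¹)) else 0)‖ ^ 2
        else 0))) := by
  -- the R-row inhabitant (✓p840511 (O3-R)) with its class inputs read off (BKG), then ✓p840525 BY NAME
  obtain ⟨R, hR0, hR, hRa⟩ := exists_remainderRow_of_bkg F U₀ X C_B α hCB hα hBKG hρ0 hρr ha0 ha Mb hMb0 hMb hMb16 Olev hO0 hOSC hρα hρδ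
  exact c1Budget_discharged_supDecay F hJK Cst hCst U₀ ζ X hXdef Mg hMg hMg4 C_B α hCB hα hBKG h24 hSU R hR0 hR
    (fun (i : ℕ) => match i with
          | 0 => (0 : ℝ)
          | i' + 1 => 16 * (54 * (((((F.P K).d + 2) * (F.P K).L : ℕ) : ℝ) * (Real.exp a₀ - 1))) * Olev (i' + 1) / (a₀ - Mb i') ^ 2 + 32 * (54 * (((((F.P K).d + 2) * (F.P K).L : ℕ) : ℝ) * (Real.exp a₀ - 1))) * Olev (i' + 1) / a₀ ^ 2 +
              ((((F.P K).d + 2) * (F.P K).L : ℕ) : ℝ) ^ 3 * (Mb i') ^ 2 + 8 * (67 * (((((F.P K).d + 2) * (F.P K).L : ℕ) : ℝ) * ((((F.P K).d - 1 : ℕ) : ℝ) * ((3 * (F.P K).L : ℕ) : ℝ) * (fun n : ℕ => 2 * ((C_B + 1) * α * (F.L : ℝ) ^ (2 * (n - 1)) * ((F.L : ℝ)⁻¹) ^ (2 * (K - J)))) (i' + 1)))) * Mb i' / a₀ ^ 2 : ℕ → ℝ)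
    A hRa haA c hc0 hc4 hζc Mbar hM0 hM1 hM

end Summit.QuantumFields.YangMills.Theorems.FluctuationComparisonRegPrIntLS2BetaCurlBudgetInhabitedR

end
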